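import Literature.Probability.FitznerVanDerHofstad2017.NobleKSpaceRewritePhi
import Literature.Probability.FitznerVanDerHofstad2017.NobleCosineSplit
import HarnessLib

/-!
# [NoBLE17] Prop. 4.5(ii) / App. D Step 1 — the F-side split `F = c_F δ + α_F D + R_F` and (D.3)

Module 3b of the kernel reconstruction of [NoBLE17] App. D for percolation (module 1:
`NobleKSpaceRewrite` — the k-space rewrite (4.22)–(4.25); module 2: `NobleKSpaceRewritePhi` — the Φ-side
constants `c_Φ, α_Φ, R_Φ` and (D.2), (D.4), (D.14); module 3a: `NobleCosineSplit` — Lemma 2.12 and the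
Step 5 mechanism).

## What is proved here
* `nobleFAlpha S` — the local part `F^α` of `F_p` ([NoBLE17] §4.1.3 (4.15)–(4.17)): the contribution of the
  seed `u` to `F₀ = μ_p Σ_ι (u_ι + Ψ^ι ⋆ u_ι)` (`μ_p c_p Σ_ι (δ_{0,x+e_ι} − μ_p δ_{0,x})`, `c_p = (1−μ_p²)⁻¹`),
  the `α_I`/`α_II` parts of `Ψ^{(N),ι} ⋆ u_ι` for `N ≤ 1`
  (`μ_p c_p Σ_ι Σ_{N≤1} (−1)^N (Ψ^{(N),ι}_{α,I}(x+e_ι) − μ_p Ψ^{(N),ι}_{α,II}(x))`), and the `α`-part of the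
  term `1 × e^{−ik_ι} Π̂^{(0),ι,κ} × e^{−ik_κ}` of `F₁` (`−μ_p c_p² Σ_{ι,κ} Π^{(0),ι,κ}_α(x+e_ι+e_κ)`), exactly
  the terms the print moves into `c_F` and `α_F` ((4.16) and the displayed formulas for `c_F`, `α_F` on p. 1083);
* `nobleCF S := F^α(0)` (= `c_F`), `nobleAlphaF S := Σ_η F^α(e_η)` (= `α_F`; `= 2d F^α(e_1)` under total
  rotational symmetry, `nobleAlphaF_eq_two_d_mul`), `nobleFRem S := F − c_F δ − (α_F/2d)·NN` (= `R_F`);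
* `nobleFAlpha_support`, `isTRS_nobleFAlpha`, `nobleFRem_eq` — `F^α` is supported in `‖x‖₂ ≤ 1`, is totally
  rotationally symmetric (given Assumption 4.1 and the TRS of the two SHIFTED `α`-sums, hypotheses `hI`, `hPi`,
  proved for the percolation split), hence `R_F = F − F^α`;
* `nobleAlphaF_eq` — the closed form
  `α_F = μ_p c_p (2d + Σ_{ι,κ}(Ψ^{(0),ι}_{α,I}−Ψ^{(1),ι}_{α,I})(e_ι+e_κ) − μ_p Σ_{ι,κ}(Ψ^{(0),ι}_{α,II}−Ψ^{(1),ι}_{α,II})(e_κ)) − μ_p c_p² Σ_{ι,κ} Π^{(0),ι,κ}_α(e_ι)`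
  (no symmetry needed);
* **(D.3)** `noble_alphaF_lower` — `α̲_F(i) ≤ α_F` from Assumption 4.3 ((4.40)–(4.42), (4.30) `β_{μ,low} ≤ μ_p`,
  `μ_p ≤ Inputs.mu`), under the decidable side condition (N4) `0 ≤ α̲_F(i)` (the print's monotonicity step
  "we bound μ on the left-hand side from below by β_{μ,low}" is valid only while the bracket
  `1 − PsiI − μ PsiII − PiA/(1−μ²)` is non-negative; cf. `BetaMap.betaAfLow_anti_fn`, which carries the same
  positivity hypothesis);
* `nobleSimplifiedFormAt_of_assumptions₃` / `nobleSimplifiedFormAt_percolation₃` — Prop. 4.5(ii) with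
  `c_Φ, α_Φ, R_Φ, c_F, α_F, R_F` ALL CONSTRUCTED and (D.2), (D.3), (D.4), (D.14) PROVED; the single remaining
  analytic hypothesis is now LITERALLY (D.32) for the constructed remainder:
  `hRF : ∀ k, −β_{ΔR_F}(i)(1 − D̂(k)) ≤ R̂_F(0) − R̂_F(k)` (App. D Steps 3–5, (D.15)–(D.32)), next to the
  decidable sign conditions (N1') `0 ≤ c̲_Φ(i)`, (N2) `β^abs_Ξ + β^abs_{Ξ^ι} < 1`, (N3) `β_Ψ(i) < 1`,
  (N4) `0 ≤ α̲_F(i)`;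
* `nobleFRem_lower_of_majorant`, `nobleSimplifiedFormAt_of_assumptions₄` / `…_percolation₄` — Step 5
  (Lemma 2.12, module 3a) applied to `R_F`: (D.32) follows from — and the residual may equivalently be given
  as — a totally rotationally symmetric summable majorant `m ≥ R_F⁻` with `Σ_x ‖x‖₂² m(x) ≤ β_{ΔR_F}(i)`,
  which is exactly what App. D Steps 3–4 ((D.15)–(D.31)) construct and bound.

## Readings recorded (HOME/DIVERGENCE.md D63)
(a) As on the Φ-side (D61), the constants are extracted from the DIRECTION-SUMMED `F` ((4.15) summed over
`ι`): `c_F = F^α(0)`, `α_F = Σ_η F^α(e_η)`; the print's per-direction formulas (p. 1083, "c_F = …",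
"α_F = …", written for `ι = 1` and multiplied by `2d`) give the same numbers under the symmetry of
Assumption 4.1, and the direction-summed form makes (D.3) symmetry-free.  (b) (N4) is an extra, decidable
side condition (at the published `d = 11` table `α̲_F = 0.98838 > 0`, HOME/NUMERICS.md §A).  (c) Which terms
of `F₁` enter `α_F` is a CHOICE ((4.16): "this is not the only possible split"); we follow the print: only the
`Π^{(0)}_α` term with both shifts.
[cite: FitznerVanDerHofstad2016NoBLE, §4.1.3 (4.15)–(4.17) and the formulas for c_F, α_F, R_F (pp. 1082–1083);
Assumption 4.1 (4.26)–(4.28) (p. 1085); Assumption 4.3 (4.30), (4.40)–(4.42) (pp. 1086–1087); Prop. 4.5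
(p. 1088); App. D Step 1 (D.3) (p. 1111), Step 5 (D.32) (p. 1117)] [cite: FitznerVanDerHofstad2017, §3.4–§3.5
(EJP pp. 27–30)]
-/

noncomputable section

namespace Literature.Probability.FitznerVanDerHofstad2017

open _root_.MeasureTheory _root_.Filter _root_.Topology Literature.Probability.LatticeModels
open Literature.Barriers.CriticalPhenomena Literature.Probability.Percolation
open scoped BigOperators

variable {d : ℕ}

/-! ## Part A. Small lattice lemmas -/

section Lattice

local notation "𝐞" => Literature.Probability.Percolation.stepVec

/-- `e_η + e_κ = 0 ↔ κ = −η`. [folklore] -/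
theorem stepVec_add_stepVec_eq_zero_iff (η κ : Fin d × Bool) : (𝐞 η : Site d) + 𝐞 κ = 0 ↔ κ = srev η := by
  constructor
  · intro h
    have h1 : (𝐞 κ : Site d) = 𝐞 (srev η) := by
      rw [stepVec_srev]; exact eq_neg_of_add_eq_zero_right h
    exact stepVec_injective' h1
  · rintro rfl
    rw [stepVec_srev, add_neg_cancel]

/-- `Σ_ι δ_{0,x+e_ι} = NN(x)` (the number of unit vectors equal to `−x`, i.e. `𝟙{‖x‖₂ = 1}`). [folklore] -/
theorem sum_nobleDelta_add_stepVec (x : Site d) : ∑ ι : Fin d × Bool, nobleDelta (x + 𝐞 ι) = nobleNN x := by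
  rw [nobleNN_eq_sum]
  exact Fintype.sum_equiv (srevEquiv d) _ _ fun ι => by
    show nobleDelta (x + 𝐞 ι) = nobleDelta (x - 𝐞 (srev ι))
    rw [stepVec_srev, sub_neg_eq_add]

/-- `δ_{0,σx} = δ_{0,x}` for a signed coordinate permutation `σ`. [folklore] -/
theorem nobleDelta_zdSignedPermIso (π : Equiv.Perm (Fin d)) (ε : Fin d → ℤˣ) (y : Site d) :
    nobleDelta (zdSignedPermIso π ε y) = nobleDelta y := by
  have h0 : zdSignedPermIso π ε (0 : Site d) = 0 := iso_map_zero _ (zdSignedPermIso_sub π ε)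
  have h : zdSignedPermIso π ε y = 0 ↔ y = 0 :=
    ⟨fun hy => (zdSignedPermIso π ε).injective (hy.trans h0.symm), fun hy => by rw [hy, h0]⟩
  simp only [nobleDelta, h]

/-- `x ↦ Σ_κ δ_{0,x−e_κ}` (`= NN(x)`, `nobleNN_eq_sum`) is totally rotationally symmetric. [folklore] -/
theorem isTRS_sum_nobleDelta_sub_stepVec :
    IsTRS (fun x : Site d => ∑ κ : Fin d × Bool, nobleDelta (x - 𝐞 κ)) :=
  isTRS_sum_of_relabel (fun e x => nobleDelta (x - e)) fun π ε e x => by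
    show nobleDelta (zdSignedPermIso π ε x - zdSignedPermIso π ε e) = nobleDelta (x - e)
    rw [← zdSignedPermIso_sub, nobleDelta_zdSignedPermIso]

/-- `NN(p(x;ν,δ)) = NN(x)`. [folklore] -/
theorem nobleNN_siteSymm (ν : Equiv.Perm (Fin d)) (δ : Fin d → Bool) (x : Site d) :
    nobleNN (siteSymm ν δ x) = nobleNN x := by
  rw [nobleNN_eq_sum, nobleNN_eq_sum]
  exact isTRS_sum_nobleDelta_sub_stepVec ν δ x

/-- `σ(x + y) = σx + σy` for a signed coordinate permutation `σ`. [folklore] -/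
theorem zdSignedPermIso_add (π : Equiv.Perm (Fin d)) (ε : Fin d → ℤˣ) (x y : Site d) :
    zdSignedPermIso π ε (x + y) = zdSignedPermIso π ε x + zdSignedPermIso π ε y := by
  have h1 := zdSignedPermIso_sub π ε (x + y) y
  rw [add_sub_cancel_right] at h1
  exact sub_eq_iff_eq_add.1 h1.symm

end Lattice

/-! ## Part B. The local part `F^α` of `F_p` and the constants `c_F`, `α_F` ([NoBLE17] §4.1.3) -/

section FAlpha

local notation "𝐞" => Literature.Probability.Percolation.stepVec

variable {p : unitInterval} {i : BetaMap.Inputs} {S : NobleSplit d p}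

/-- **`F^α`** — the part of `F_p = F₀ + F₁ + …` that [NoBLE17] §4.1.3 moves into `c_F δ + α_F D`: with
`c_p = (1−μ_p²)⁻¹`,
`F^α(x) = μ_p c_p Σ_ι [ (δ_{0,x+e_ι} − μ_p δ_{0,x}) + Σ_{N≤1}(−1)^N (Ψ^{(N),ι}_{α,I}(x+e_ι) − μ_p Ψ^{(N),ι}_{α,II}(x)) ] − μ_p c_p² Σ_{ι,κ} Π^{(0),ι,κ}_α(x+e_ι+e_κ)`
(the x-space form of (4.15)–(4.16) and of the term `μ_p c_p² Σ_{ι,κ} e^{−ik_ι} Π̂^{ι,κ}_α(k) e^{−ik_κ}` of `F̂₁`).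
[cite: FitznerVanDerHofstad2016NoBLE, §4.1.3 (4.15)–(4.17), formulas for c_F and α_F (pp. 1082–1083)] -/
def nobleFAlpha (S : NobleSplit d p) (x : Site d) : ℝ :=
  nobleMu d p * (1 - nobleMu d p ^ 2)⁻¹ *
      ∑ ι : Fin d × Bool, ((nobleDelta (x + 𝐞 ι) - nobleMu d p * nobleDelta x) +
        ((S.psiAI 0 ι (x + 𝐞 ι) - S.psiAI 1 ι (x + 𝐞 ι)) -
          nobleMu d p * (S.psiAII 0 ι x - S.psiAII 1 ι x))) -
    nobleMu d p * ((1 - nobleMu d p ^ 2)⁻¹) ^ 2 *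
      ∑ ι : Fin d × Bool, ∑ κ : Fin d × Bool, S.piA ι κ (x + 𝐞 ι + 𝐞 κ)

/-- **`c_F := F^α(0)`**. [cite: FitznerVanDerHofstad2016NoBLE, §4.1.3, formula for c_F (p. 1083)] -/
def nobleCF (S : NobleSplit d p) : ℝ := nobleFAlpha S 0

/-- **`α_F := Σ_η F^α(e_η)`** (`= 2d F^α(e_1)` under total rotational symmetry).
[cite: FitznerVanDerHofstad2016NoBLE, §4.1.3, formula for α_F (p. 1083)] -/
def nobleAlphaF (S : NobleSplit d p) : ℝ := ∑ η : Fin d × Bool, nobleFAlpha S (𝐞 η)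

/-- **`R_F := F − c_F δ − (α_F/2d) NN`**, i.e. `R̂_F(k) = F̂(k) − c_F − α_F D̂(k)` ((4.17)).
[cite: FitznerVanDerHofstad2016NoBLE, §4.1.3 (4.17) and R_F (p. 1083)] -/
def nobleFRem (S : NobleSplit d p) : Site d → ℝ := nobleRem (nobleF d p) (nobleCF S) (nobleAlphaF S)

/-- `F^α` regrouped: `μc (NN − 2dμ δ + (A₀ − A₁) − μ (B₀ − B₁)) − μ c² Π` with the direction sums
`A_N(x) = Σ_ι Ψ^{(N),ι}_{α,I}(x+e_ι)`, `B_N(x) = Σ_ι Ψ^{(N),ι}_{α,II}(x)`. [folklore] -/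
theorem nobleFAlpha_eq_pieces (S : NobleSplit d p) (x : Site d) :
    nobleFAlpha S x = nobleMu d p * (1 - nobleMu d p ^ 2)⁻¹ *
        (nobleNN x - 2 * d * nobleMu d p * nobleDelta x +
          (((∑ ι, S.psiAI 0 ι (x + 𝐞 ι)) - ∑ ι, S.psiAI 1 ι (x + 𝐞 ι)) -
            nobleMu d p * ((∑ ι, S.psiAII 0 ι x) - ∑ ι, S.psiAII 1 ι x))) -
      nobleMu d p * ((1 - nobleMu d p ^ 2)⁻¹) ^ 2 * ∑ ι, ∑ κ, S.piA ι κ (x + 𝐞 ι + 𝐞 κ) := by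
  rw [nobleFAlpha, ← sum_nobleDelta_add_stepVec x]
  simp only [Finset.sum_add_distrib, Finset.sum_sub_distrib, ← Finset.mul_sum, sum_const_dir]
  ring

/-- `F^α` vanishes outside the unit ball `‖x‖₂ ≤ 1` (supports (4.37), (4.41), (4.42)).
[cite: FitznerVanDerHofstad2016NoBLE, §4.1.3 (4.16)–(4.17) (p. 1083)] -/
theorem nobleFAlpha_support (S : NobleSplit d p) (x : Site d) (hx : 1 < euclidNorm x) : nobleFAlpha S x = 0 := by
  have hx0 : x ≠ 0 := by
    rintro rfl; rw [euclidNorm_zero'] at hx; exact absurd hx (by norm_num)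
  have hxκ : ∀ κ, x ≠ 𝐞 κ := by
    rintro κ rfl; rw [euclidNorm_stepVec] at hx; exact lt_irrefl _ hx
  have hNN : nobleNN x = 0 := nobleNN_eq_zero hxκ
  have hδ : nobleDelta x = 0 := by rw [nobleDelta, if_neg hx0]
  have hA : ∀ N ≤ 1, ∑ ι, S.psiAI N ι (x + 𝐞 ι) = 0 := fun N hN =>
    Finset.sum_eq_zero fun ι _ => S.psiAI_support N hN ι x hx
  have hB : ∀ N ≤ 1, ∑ ι, S.psiAII N ι x = 0 := fun N hN =>
    Finset.sum_eq_zero fun ι _ => S.psiAII_support N hN ι x hx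
  have hPi : ∑ ι, ∑ κ, S.piA ι κ (x + 𝐞 ι + 𝐞 κ) = 0 := by
    refine Finset.sum_eq_zero fun ι _ => Finset.sum_eq_zero fun κ _ => S.piA_support ι κ _ ?_ ?_
    · intro h
      have h2 : x + 𝐞 κ = 0 := by
        have h3 : x + 𝐞 κ + 𝐞 ι = 0 + 𝐞 ι := by rw [zero_add, add_right_comm]; exact h
        exact add_right_cancel h3
      exact hxκ (srev κ) (by rw [stepVec_srev]; exact eq_neg_of_add_eq_zero_left h2)
    · intro h
      have h3 : x + (𝐞 ι + 𝐞 κ) = 0 + (𝐞 ι + 𝐞 κ) := by rw [← add_assoc, zero_add]; exact h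
      exact hx0 (add_right_cancel h3)
  rw [nobleFAlpha_eq_pieces, hNN, hδ, hA 0 zero_le_one, hA 1 le_rfl, hB 0 zero_le_one, hB 1 le_rfl, hPi]
  ring

/-- The direction sum `x ↦ Σ_ι Ψ^{(N),ι}_{α,II}(x)` (`N ≤ 1`) is totally rotationally symmetric, by
Assumption 4.1 ((4.27) for `Σ_ι Ψ^{(N),ι}` and (4.28) for `Σ_ι Ψ^{(N),ι}_{R,II}`).
[cite: FitznerVanDerHofstad2016NoBLE, Assumption 4.1 (4.27)–(4.28) (p. 1085)] -/
theorem isTRS_sum_psiAII (h41 : NobleAssumption41At d p S) {N : ℕ} (hN : N ≤ 1) :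
    IsTRS (fun x => ∑ ι, S.psiAII N ι x) := by
  have h1 : (fun x => ∑ ι, S.psiAII N ι x) =
      fun x => (∑ ι, noblePsiN d p (𝐞 ι) N x) - ∑ ι, S.psiRII N ι x := by
    funext x
    rw [← Finset.sum_sub_distrib]
    exact Finset.sum_congr rfl fun ι _ => by rw [NobleSplit.psiRII, sub_sub_cancel]
  rw [h1]
  exact (h41.psiSum_trs N).sub (h41.psiRIISum_trs N hN)

/-- `F^α` is totally rotationally symmetric, given Assumption 4.1 and the TRS of the two shifted `α`-sums
`x ↦ Σ_ι Ψ^{(N),ι}_{α,I}(x+e_ι)` (`N ≤ 1`) and `x ↦ Σ_{ι,κ} Π^{(0),ι,κ}_α(x+e_ι+e_κ)` (used silently in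
(4.16): "by symmetry"; theorems for the percolation split, Part D).
[cite: FitznerVanDerHofstad2016NoBLE, §4.1.3 (4.16) (p. 1083); Assumption 4.1 (p. 1085)] -/
theorem isTRS_nobleFAlpha (h41 : NobleAssumption41At d p S)
    (hI : ∀ N ≤ 1, IsTRS (fun x => ∑ ι, S.psiAI N ι (x + 𝐞 ι)))
    (hPi : IsTRS (fun x => ∑ ι, ∑ κ, S.piA ι κ (x + 𝐞 ι + 𝐞 κ))) : IsTRS (nobleFAlpha S) := by
  intro ν δ x
  have hA0 : ∑ ι, S.psiAI 0 ι (siteSymm ν δ x + 𝐞 ι) = ∑ ι, S.psiAI 0 ι (x + 𝐞 ι) := hI 0 zero_le_one ν δ x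
  have hA1 : ∑ ι, S.psiAI 1 ι (siteSymm ν δ x + 𝐞 ι) = ∑ ι, S.psiAI 1 ι (x + 𝐞 ι) := hI 1 le_rfl ν δ x
  have hB0 : ∑ ι, S.psiAII 0 ι (siteSymm ν δ x) = ∑ ι, S.psiAII 0 ι x := isTRS_sum_psiAII h41 zero_le_one ν δ x
  have hB1 : ∑ ι, S.psiAII 1 ι (siteSymm ν δ x) = ∑ ι, S.psiAII 1 ι x := isTRS_sum_psiAII h41 le_rfl ν δ x
  have hP : ∑ ι, ∑ κ, S.piA ι κ (siteSymm ν δ x + 𝐞 ι + 𝐞 κ) = ∑ ι, ∑ κ, S.piA ι κ (x + 𝐞 ι + 𝐞 κ) :=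
    hPi ν δ x
  rw [nobleFAlpha_eq_pieces, nobleFAlpha_eq_pieces, nobleNN_siteSymm ν δ x, isTRS_nobleDelta ν δ x, hA0, hA1,
    hB0, hB1, hP]

/-- `Σ_κ Π^{(0),ι,κ}_α(e_η + e_ι + e_κ) = Π^{(0),ι,−η}_α(e_ι)`: by (4.42) only `κ = −η` contributes. [folklore] -/
theorem sum_piA_shift_stepVec (S : NobleSplit d p) (η ι : Fin d × Bool) :
    ∑ κ, S.piA ι κ (𝐞 η + 𝐞 ι + 𝐞 κ) = S.piA ι (srev η) (𝐞 ι) := by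
  rw [Finset.sum_eq_single (srev η)]
  · rw [stepVec_srev]; congr 1; abel
  · intro κ _ hκ
    refine S.piA_support ι κ _ (fun h => hκ ?_) (fun h => stepVec_ne_zero_site η ?_)
    · have h2 : (𝐞 η : Site d) + 𝐞 κ = 0 := by
        have h3 : (𝐞 η : Site d) + 𝐞 κ + 𝐞 ι = 0 + 𝐞 ι := by rw [zero_add, add_right_comm]; exact h
        exact add_right_cancel h3
      exact (stepVec_add_stepVec_eq_zero_iff η κ).1 h2
    · have h3 : (𝐞 η : Site d) + (𝐞 ι + 𝐞 κ) = 0 + (𝐞 ι + 𝐞 κ) := by rw [← add_assoc, zero_add]; exact h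
      exact add_right_cancel h3
  · intro h; exact absurd (Finset.mem_univ _) h

/-- `F^α` at a unit vector:
`F^α(e_η) = μc (1 + Σ_ι (Ψ^{(0),ι}_{α,I} − Ψ^{(1),ι}_{α,I})(e_η+e_ι) − μ Σ_ι (Ψ^{(0),ι}_{α,II} − Ψ^{(1),ι}_{α,II})(e_η)) − μc² Σ_ι Π^{(0),ι,−η}_α(e_ι)`.
[cite: FitznerVanDerHofstad2016NoBLE, §4.1.3, formula for α_F (p. 1083)] -/
theorem nobleFAlpha_stepVec (S : NobleSplit d p) (η : Fin d × Bool) :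
    nobleFAlpha S (𝐞 η) = nobleMu d p * (1 - nobleMu d p ^ 2)⁻¹ *
        (1 + ((∑ ι, S.psiAI 0 ι (𝐞 η + 𝐞 ι)) - ∑ ι, S.psiAI 1 ι (𝐞 η + 𝐞 ι)) -
          nobleMu d p * ((∑ ι, S.psiAII 0 ι (𝐞 η)) - ∑ ι, S.psiAII 1 ι (𝐞 η))) -
      nobleMu d p * ((1 - nobleMu d p ^ 2)⁻¹) ^ 2 * ∑ ι, S.piA ι (srev η) (𝐞 ι) := by
  have hδ : nobleDelta (𝐞 η : Site d) = 0 := by rw [nobleDelta, if_neg (stepVec_ne_zero_site η)]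
  rw [nobleFAlpha_eq_pieces, nobleNN_stepVec, hδ, Finset.sum_congr rfl fun ι _ => sum_piA_shift_stepVec S η ι]
  ring

/-- **Closed form of `α_F`** (no symmetry needed):
`α_F = μ_p c_p (2d + Σ_{ι,κ}(Ψ^{(0),ι}_{α,I}−Ψ^{(1),ι}_{α,I})(e_ι+e_κ) − μ_p Σ_{ι,κ}(Ψ^{(0),ι}_{α,II}−Ψ^{(1),ι}_{α,II})(e_κ)) − μ_p c_p² Σ_{ι,κ} Π^{(0),ι,κ}_α(e_ι)`.
[cite: FitznerVanDerHofstad2016NoBLE, §4.1.3, formula for α_F (p. 1083)] -/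
theorem nobleAlphaF_eq (S : NobleSplit d p) :
    nobleAlphaF S = nobleMu d p * (1 - nobleMu d p ^ 2)⁻¹ *
        (2 * d + (∑ ι, ∑ κ, (S.psiAI 0 ι (𝐞 ι + 𝐞 κ) - S.psiAI 1 ι (𝐞 ι + 𝐞 κ))) -
          nobleMu d p * ∑ ι, ∑ κ, (S.psiAII 0 ι (𝐞 κ) - S.psiAII 1 ι (𝐞 κ))) -
      nobleMu d p * ((1 - nobleMu d p ^ 2)⁻¹) ^ 2 * ∑ ι, ∑ κ, S.piA ι κ (𝐞 ι) := by
  have hI : ∀ N : ℕ, ∑ η : Fin d × Bool, ∑ ι, S.psiAI N ι (𝐞 η + 𝐞 ι) = ∑ ι, ∑ κ, S.psiAI N ι (𝐞 ι + 𝐞 κ) := by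
    intro N
    rw [Finset.sum_comm]
    exact Finset.sum_congr rfl fun ι _ => Finset.sum_congr rfl fun κ _ => by rw [add_comm]
  have hII : ∀ N : ℕ, ∑ η : Fin d × Bool, ∑ ι, S.psiAII N ι (𝐞 η) = ∑ ι, ∑ κ, S.psiAII N ι (𝐞 κ) := fun N =>
    Finset.sum_comm
  have hP : ∑ η : Fin d × Bool, ∑ ι, S.piA ι (srev η) (𝐞 ι) = ∑ ι, ∑ κ, S.piA ι κ (𝐞 ι) := by
    rw [Finset.sum_comm]
    exact Finset.sum_congr rfl fun ι _ => Fintype.sum_equiv (srevEquiv d) _ _ fun η => rfl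
  have hI' : ∀ N : ℕ, ∑ η : Fin d × Bool, ∑ ι, S.psiAI N ι (𝐞 η + 𝐞 ι) = ∑ ι, ∑ κ, S.psiAI N ι (𝐞 ι + 𝐞 κ) :=
    hI
  unfold nobleAlphaF
  simp only [nobleFAlpha_stepVec]
  rw [Finset.sum_sub_distrib, ← Finset.mul_sum, ← Finset.mul_sum, hP]
  congr 1
  rw [Finset.sum_sub_distrib, Finset.sum_add_distrib, sum_const_dir, ← Finset.mul_sum, Finset.sum_sub_distrib,
    Finset.sum_sub_distrib, hI' 0, hI' 1, hII 0, hII 1]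
  simp only [Finset.sum_sub_distrib]
  ring

/-- `α_F = 2d F^α(e_η)` under total rotational symmetry of `F^α`.
[cite: FitznerVanDerHofstad2016NoBLE, §4.1.3, formula for α_F (p. 1083)] -/
theorem nobleAlphaF_eq_two_d_mul (hT : IsTRS (nobleFAlpha S)) (η : Fin d × Bool) :
    nobleAlphaF S = 2 * d * nobleFAlpha S (𝐞 η) := by
  rw [nobleAlphaF, hT.two_d_mul_apply_stepVec η]

/-- **`R_F = F − F^α`** (given the symmetry of `F^α`): the defining identity (4.17)
`F̂(k) = c_F + α_F D̂(k) + R̂_F(k)`. [cite: FitznerVanDerHofstad2016NoBLE, §4.1.3 (4.17) (p. 1083)] -/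
theorem nobleFRem_eq [NeZero d] (hT : IsTRS (nobleFAlpha S)) (x : Site d) :
    nobleFRem S x = nobleF d p x - nobleFAlpha S x := by
  have hd0 : (2 * d : ℝ) ≠ 0 := mul_ne_zero two_ne_zero (Nat.cast_ne_zero.2 (NeZero.ne d))
  obtain ⟨η⟩ : Nonempty (Fin d × Bool) := ⟨(⟨0, Nat.pos_of_ne_zero (NeZero.ne d)⟩, true)⟩
  rw [nobleFRem, nobleRem, nobleCF, nobleAlphaF_eq_two_d_mul hT η,
    hT.eq_delta_add_nn (fun y hy => nobleFAlpha_support S y hy) η x, mul_div_cancel_left₀ _ hd0]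
  ring

end FAlpha

/-! ## Part C. (D.3): `α̲_F(i) ≤ α_F` -/

section D3

local notation "𝐞" => Literature.Probability.Percolation.stepVec

variable {p : unitInterval} {i : BetaMap.Inputs} {S : NobleSplit d p}

/-- **[NoBLE17] (D.3), lower half: `α̲_F(i) ≤ α_F`.**  From the closed form of `α_F`, (4.40)
`Σ_κ(Ψ^{(1),ι}_{α,I}−Ψ^{(0),ι}_{α,I})(e_ι+e_κ) ≤ β`, (4.41) `Σ_κ(Ψ^{(0),ι}_{α,II}−Ψ^{(1),ι}_{α,II})(e_κ) ≤ β`,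
(4.42) `Σ_κ Π^{(0),ι,κ}_α(e_ι) ≤ β`, `β_{μ,low} ≤ μ_p ≤ μ̄(i) < 1` and the monotonicity of `μ ↦ μ/(1−μ²)`;
the step "bound μ from below by β_{μ,low}" needs the bracket to be non-negative, which is the side
condition (N4) `0 ≤ α̲_F(i)` (`= betaAfLow`, whose leading factor `2dβ_{μ,low}/(1−β_{μ,low}²)` is positive).
[cite: FitznerVanDerHofstad2016NoBLE, App. D Step 1 (D.3) (p. 1111); Assumption 4.3 (4.30), (4.40)–(4.42)
(pp. 1086–1087)] -/
theorem noble_alphaF_lower (hd : 1 ≤ d) (hWF : NobleInputsWF d i) (h43 : NobleAssumption43At d p S i)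
    (hN4 : 0 ≤ (BetaMap.nobleBetaOfInputs d i).αFlow) :
    (BetaMap.nobleBetaOfInputs d i).αFlow ≤ nobleAlphaF S := by
  have hαdef : (BetaMap.nobleBetaOfInputs d i).αFlow = BetaMap.betaAfLow d i.muMin i.mu
      i.psiAlphaIOneMinusZeroAroundEi i.psiAlphaIIZeroMinusOneAroundZero i.piAlpha := rfl
  rw [hαdef] at hN4 ⊢
  unfold BetaMap.betaAfLow at hN4 ⊢
  -- abbreviations
  set μ := nobleMu d p with hμ
  set m := i.mu with hm
  set m0 := i.muMin with hm0
  set P1 := i.psiAlphaIOneMinusZeroAroundEi with hP1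
  set P2 := i.psiAlphaIIZeroMinusOneAroundZero with hP2
  set P3 := i.piAlpha with hP3
  set AI := ∑ ι, ∑ κ, (S.psiAI 0 ι (𝐞 ι + 𝐞 κ) - S.psiAI 1 ι (𝐞 ι + 𝐞 κ)) with hAI
  set AII := ∑ ι, ∑ κ, (S.psiAII 0 ι (𝐞 κ) - S.psiAII 1 ι (𝐞 κ)) with hAII
  set C := ∑ ι, ∑ κ, S.piA ι κ (𝐞 ι) with hC
  -- scalar facts
  have hdpos : (0 : ℝ) < d := Nat.cast_pos.2 hd
  have hμ0 : 0 ≤ μ := nobleMu_nonneg d p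
  have hμm : μ ≤ m := h43.mu_le
  have hm1 : m < 1 := hWF.1.mu_lt_one
  have hμ1 : μ < 1 := lt_of_le_of_lt hμm hm1
  have hm0μ : m0 ≤ μ := h43.muMin
  have hm00 : 0 < m0 := hWF.2.2
  have hm01 : m0 < 1 := hWF.1.muMin_lt_one
  have hP1n : 0 ≤ P1 := hWF.1.psiAlphaIOneMinusZeroAroundEi
  have hP2n : 0 ≤ P2 := hWF.1.psiAlphaIIZeroMinusOneAroundZero
  have hP3n : 0 ≤ P3 := hWF.1.piAlpha
  have hcμ : 0 < 1 - μ ^ 2 := by nlinarith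
  have hcm : 0 < 1 - m ^ 2 := by nlinarith
  have hcm0 : 0 < 1 - m0 ^ 2 := by nlinarith
  have hcμm : (1 - μ ^ 2)⁻¹ ≤ 1 / (1 - m ^ 2) := by
    rw [one_div]; exact inv_anti₀ hcm (by nlinarith)
  have hcμ0 : 0 ≤ (1 - μ ^ 2)⁻¹ := inv_nonneg.2 hcμ.le
  -- the three Assumption-4.3 aggregates
  have hAI' : -(2 * d * P1) ≤ AI := by
    have := Finset.sum_le_sum fun ι (_ : ι ∈ Finset.univ) => h43.psiAlphaIAroundEi_lower ι
    rw [sum_const_dir] at this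
    linarith
  have hAII' : AII ≤ 2 * d * P2 := by
    have := Finset.sum_le_sum fun ι (_ : ι ∈ Finset.univ) => h43.psiAlphaIIAroundZero_upper ι
    rw [sum_const_dir] at this
    exact this
  have hC' : C ≤ 2 * d * P3 := by
    have := Finset.sum_le_sum fun ι (_ : ι ∈ Finset.univ) => h43.piAlpha_upper ι
    rw [sum_const_dir] at this
    exact this
  have hC0 : 0 ≤ C := Finset.sum_nonneg fun ι _ => Finset.sum_nonneg fun κ _ => S.piA_nonneg ι κ _
  -- the bracket
  set X := 1 - P1 - m * P2 - 1 / (1 - m ^ 2) * P3 with hX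
  have hX0 : 0 ≤ X := by
    by_contra hc
    have hg : 0 < 2 * d * m0 / (1 - m0 ^ 2) := by positivity
    have := mul_neg_of_pos_of_neg hg (not_le.mp hc)
    linarith
  -- α_F = μ c Y with Y ≥ 2d X
  have hY : 2 * d * X ≤ 2 * d + AI - μ * AII - (1 - μ ^ 2)⁻¹ * C := by
    have h1 : μ * AII ≤ m * (2 * d * P2) :=
      (mul_le_mul_of_nonneg_left hAII' hμ0).trans (mul_le_mul_of_nonneg_right hμm (by positivity))
    have h2 : (1 - μ ^ 2)⁻¹ * C ≤ 1 / (1 - m ^ 2) * (2 * d * P3) :=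
      (mul_le_mul_of_nonneg_left hC' hcμ0).trans (mul_le_mul_of_nonneg_right hcμm (by positivity))
    rw [hX]
    nlinarith
  have hg0 : m0 / (1 - m0 ^ 2) ≤ μ * (1 - μ ^ 2)⁻¹ := by
    have := mu_div_one_sub_sq_mono hm00.le hm0μ hμ1
    rw [div_eq_mul_inv] at this ⊢
    -- this : m0 * (1 - m0^2)⁻¹ ≤ μ / (1 - μ^2)
    simpa [div_eq_mul_inv] using this
  have hαF : nobleAlphaF S = μ * (1 - μ ^ 2)⁻¹ * (2 * d + AI - μ * AII - (1 - μ ^ 2)⁻¹ * C) := by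
    rw [nobleAlphaF_eq]; ring
  rw [hαF]
  calc 2 * d * m0 / (1 - m0 ^ 2) * X = m0 / (1 - m0 ^ 2) * (2 * d * X) := by ring
    _ ≤ μ * (1 - μ ^ 2)⁻¹ * (2 * d * X) :=
        mul_le_mul_of_nonneg_right hg0 (by positivity)
    _ ≤ μ * (1 - μ ^ 2)⁻¹ * (2 * d + AI - μ * AII - (1 - μ ^ 2)⁻¹ * C) :=
        mul_le_mul_of_nonneg_left hY (mul_nonneg hμ0 hcμ0)

end D3

/-! ## Part D. The percolation split: the shifted `α`-sums are totally rotationally symmetric -/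

section Percolation

local notation "𝐞" => Literature.Probability.Percolation.stepVec

variable {p : unitInterval}

/-- For the percolation split, `x ↦ Σ_ι Ψ^{(N),ι}_{α,I}(x + e_ι)` is totally rotationally symmetric (the family
`Ψ^{(N),e}_{α,I}` is transported by the signed coordinate permutations: `noblePsiAIT_relabel`).
[cite: FitznerVanDerHofstad2017, §3.4–§3.5 (EJP pp. 27–30)] -/
theorem percolationNobleSplit_psiAI_shift_trs (hd : 2 ≤ d) (hp : p < criticalProbI d) (N : ℕ) :
    IsTRS (fun x => ∑ ι, (percolationNobleSplit d p hd hp).psiAI N ι (x + 𝐞 ι)) :=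
  isTRS_sum_of_relabel (fun e x => (p : ℝ) / nobleMu d p * (noblePsiAIT d p e N (x + e)).toReal)
    fun π ε e x => by
      show (p : ℝ) / nobleMu d p *
          (noblePsiAIT d p (zdSignedPermIso π ε e) N (zdSignedPermIso π ε x + zdSignedPermIso π ε e)).toReal =
        (p : ℝ) / nobleMu d p * (noblePsiAIT d p e N (x + e)).toReal
      rw [← zdSignedPermIso_add, noblePsiAIT_relabel _ (zdSignedPermIso_sub π ε)]

/-- For the percolation split, `x ↦ Σ_{ι,κ} Π^{(0),ι,κ}_α(x + e_ι + e_κ)` is totally rotationally symmetric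
(`noblePiA0T_relabel`). [cite: FitznerVanDerHofstad2017, §3.4–§3.5 (EJP pp. 27–30)] -/
theorem percolationNobleSplit_piA_shift_trs (hd : 2 ≤ d) (hp : p < criticalProbI d) :
    IsTRS (fun x => ∑ ι, ∑ κ, (percolationNobleSplit d p hd hp).piA ι κ (x + 𝐞 ι + 𝐞 κ)) :=
  isTRS_sum_sum_of_relabel (fun e e' x => (noblePiA0T d p e e' (x + e + e')).toReal) fun π ε e e' x => by
    show (noblePiA0T d p (zdSignedPermIso π ε e) (zdSignedPermIso π ε e')
        (zdSignedPermIso π ε x + zdSignedPermIso π ε e + zdSignedPermIso π ε e')).toReal =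
      (noblePiA0T d p e e' (x + e + e')).toReal
    rw [← zdSignedPermIso_add, ← zdSignedPermIso_add, noblePiA0T_relabel _ (zdSignedPermIso_sub π ε)]

/-- For the percolation split `F^α` is totally rotationally symmetric, so `R_F = F − F^α` unconditionally.
[cite: FitznerVanDerHofstad2016NoBLE, §4.1.3 (4.17) (p. 1083); FitznerVanDerHofstad2017, §3.5] -/
theorem isTRS_nobleFAlpha_percolation (hd : 2 ≤ d) (hp : p < criticalProbI d) :
    IsTRS (nobleFAlpha (percolationNobleSplit d p hd hp)) :=
  isTRS_nobleFAlpha (nobleAssumption41At_percolation hd p hp)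
    (fun N _ => percolationNobleSplit_psiAI_shift_trs hd hp N) (percolationNobleSplit_piA_shift_trs hd hp)

end Percolation


/-! ## Part F. Step 5 applied to `R_F`: the residual as a weighted-ℓ¹ majorant (App. D Steps 3–4) -/

section Step5F

variable {p : unitInterval} {i : BetaMap.Inputs} {S : NobleSplit d p}

/-- `R_F` is absolutely summable (below `p_c`, from the ℓ¹ bounds of Assumption 4.3 via `NobleL1At`).
[cite: FitznerVanDerHofstad2016NoBLE, §4.1.3 (4.17) (p. 1083); Assumption 4.3 (p. 1086)] -/
theorem summable_abs_nobleFRem [NeZero d] {P X : ℝ} (h : NobleL1At d p P X) (S : NobleSplit d p) :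
    Summable fun x => |nobleFRem S x| :=
  summable_abs_nobleRem (summable_abs_nobleF h) _ _

/-- **(D.32) for `R_F` from a majorant** — the interface to App. D Steps 3–4: if `m ≥ 0` is summable, totally
rotationally symmetric, with `Σ_x ‖x‖₂² m(x) ≤ β` and `−m ≤ R_F` pointwise ((D.15)–(D.31) produce such an `m`,
the sum of the absolute values of the non-local terms of `F`, with `β = β_{ΔR_F}(i)`), then
`−β(1 − D̂(k)) ≤ R̂_F(0) − R̂_F(k)` (Lemma 2.12, `displacement_lower_bound`).
[cite: FitznerVanDerHofstad2016NoBLE, App. D Steps 3–5, (D.15)–(D.32) (pp. 1113–1117); Lemma 2.12 (p. 1063)] -/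
theorem nobleFRem_lower_of_majorant [NeZero d] {P X : ℝ} (h : NobleL1At d p P X) {m : Site d → ℝ} (hm : Summable m)
    (hm0 : ∀ x, 0 ≤ m x) (hmw : Summable fun x => euclidNorm x ^ 2 * m x) (hmT : IsTRS m)
    (hRm : ∀ x, -m x ≤ nobleFRem S x) {β : ℝ} (hβ : ∑' x, euclidNorm x ^ 2 * m x ≤ β) (k : Fin d → ℝ) :
    -(β * (1 - Dhat d k)) ≤ cosFT (nobleFRem S) 0 - cosFT (nobleFRem S) k :=
  displacement_lower_bound (summable_abs_nobleFRem h S) hm hm0 hmw hmT hRm hβ k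

end Step5F

/-! ## Part E. Assembly: Prop. 4.5(ii) with all six constants constructed -/

section Assembly

local notation "𝐞" => Literature.Probability.Percolation.stepVec

variable {p : unitInterval} {i : BetaMap.Inputs} {S : NobleSplit d p}

variable (hd : 2 ≤ d) (hp : p < criticalProbI d)
include hd hp

/-- **[NoBLE17, Prop. 4.5(ii) / App. D, Steps 1–2 — theorem form].** Under the NoBLE equation at `p`,
Assumption 4.1 for the split `S`, Assumption 4.3 at `p` with constants `i` (well-formed), the TRS of the
shifted `Ξ^ι_{α,I}`-sum (automatic for percolation), the decidable sign side conditions (N1') `0 ≤ c̲_Φ(i)`,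
(N2) `β^abs_Ξ + β^abs_{Ξ^ι} < 1`, (N3) `β_Ψ(i) < 1`, (N4) `0 ≤ α̲_F(i)`, and the ONE remaining analytic
hypothesis `hRF` = (D.32) for the constructed remainder `R_F` (`−β_{ΔR_F}(i)(1 − D̂(k)) ≤ R̂_F(0) − R̂_F(k)`,
App. D Steps 3–5): the simplified rewrite holds with the tree's β-table `nobleBetaOfInputs d i`; the constants
`c_Φ, α_Φ, R_Φ, c_F, α_F, R_F` are CONSTRUCTED and (D.2), (D.3), (D.4), (D.14) are PROVED.
[cite: FitznerVanDerHofstad2016NoBLE, Prop. 4.5 (p. 1088); §4.1.3 (4.15)–(4.19) (p. 1083); App. D (D.1)–(D.4),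
(D.9)–(D.14), (D.32) (pp. 1110–1117)] -/
theorem nobleSimplifiedFormAt_of_assumptions₃ (hp0 : 0 < (p : ℝ)) (hWF : NobleInputsWF d i)
    (hE : PercolationNobleEquationAt d p) (h41 : NobleAssumption41At d p S) (h43 : NobleAssumption43At d p S i)
    (hTRS : IsTRS (fun x => ∑ ι, S.xiIotaAI ι (x + 𝐞 ι)))
    (hN1 : 0 ≤ BetaMap.betaCPhiLow d i.mu i.xiAlphaOneMinusZeroAtZero i.xiIotaAlphaIAtEi)
    (hN2 : i.xiAbs + i.xiIotaAbs < 1) (hN3 : (BetaMap.nobleBetaOfInputs d i).βΨ < 1)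
    (hN4 : 0 ≤ (BetaMap.nobleBetaOfInputs d i).αFlow)
    (hRF : ∀ k ∈ cube d, -((BetaMap.nobleBetaOfInputs d i).βΔ * (1 - Dhat d k)) ≤
      cosFT (nobleFRem S) 0 - cosFT (nobleFRem S) k) :
    NobleSimplifiedFormAt d p (BetaMap.nobleBetaOfInputs d i) := by
  haveI : NeZero d := ⟨by omega⟩
  have h := nobleL1At_of_assumption43 hd hp hp0 h43
  set η : Fin d × Bool := (⟨0, by omega⟩, true) with hη
  have hΞ : ∀ x, Summable fun N => nobleXiN d p N x :=
    (l1_of_NSumLE (fun N x => nobleXiN_nonneg p N x) h43.xiAbs).1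
  have hΞι : ∀ ι x, Summable fun N => nobleXiIotaN d p (𝐞 ι) N x := fun ι =>
    (l1_of_NSumLE (fun N x => nobleXiIotaN_nonneg p (𝐞 ι) N x) (h43.xiIotaAbs ι)).1
  have hrem : ∀ x, nobleRem (noblePhi d p) (noblePhiAlpha S 0) (2 * d * noblePhiAlpha S (𝐞 η)) x =
      noblePhiRem S x := nobleRem_noblePhi_eq h h41 hTRS hΞ hΞι η
  obtain ⟨hcL, hcU⟩ := noble_cPhi_bounds hWF h43
  have hαΦ := noble_alphaPhi_bound hWF h41 h43 hTRS η
  have hRΦ : ∑' x, |nobleRem (noblePhi d p) (noblePhiAlpha S 0) (2 * d * noblePhiAlpha S (𝐞 η)) x| ≤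
      (BetaMap.nobleBetaOfInputs d i).βRΦ := by
    rw [tsum_congr fun x => congrArg abs (hrem x)]
    exact (noblePhiRem_l1 hd hp hp0 h43).2.trans (noblePhiRemBound_le hd hWF h43)
  have hαF : (BetaMap.nobleBetaOfInputs d i).αFlow ≤ nobleAlphaF S := noble_alphaF_lower (by omega) hWF h43 hN4
  have hΔ : ∀ k ∈ cube d, -((BetaMap.nobleBetaOfInputs d i).βΔ * (1 - Dhat d k)) ≤
      cosFT (nobleRem (nobleF d p) (nobleCF S) (nobleAlphaF S)) 0 -
        cosFT (nobleRem (nobleF d p) (nobleCF S) (nobleAlphaF S)) k := hRF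
  exact nobleSimplifiedFormAt_of_assumptions hd hp hp0 hE h41 h43 hN2 hN3 (hN1.trans hcL) hcU hαΦ hαF hRΦ hΔ

/-- **Percolation instance** (`S := percolationNobleSplit d p`): Assumption 4.1 and the shifted-`α_I` TRS are
theorems, so only the NoBLE equation, Assumption 4.3 with constants `i`, the four sign conditions and (D.32)
for `R_F` remain as hypotheses. [cite: FitznerVanDerHofstad2016NoBLE, Prop. 4.5 (p. 1088), App. D
(pp. 1110–1117); FitznerVanDerHofstad2017, §3.5] -/
theorem nobleSimplifiedFormAt_percolation₃ (hp0 : 0 < (p : ℝ)) (hWF : NobleInputsWF d i)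
    (hE : PercolationNobleEquationAt d p) (h43 : NobleAssumption43At d p (percolationNobleSplit d p hd hp) i)
    (hN1 : 0 ≤ BetaMap.betaCPhiLow d i.mu i.xiAlphaOneMinusZeroAtZero i.xiIotaAlphaIAtEi)
    (hN2 : i.xiAbs + i.xiIotaAbs < 1) (hN3 : (BetaMap.nobleBetaOfInputs d i).βΨ < 1)
    (hN4 : 0 ≤ (BetaMap.nobleBetaOfInputs d i).αFlow)
    (hRF : ∀ k ∈ cube d, -((BetaMap.nobleBetaOfInputs d i).βΔ * (1 - Dhat d k)) ≤
      cosFT (nobleFRem (percolationNobleSplit d p hd hp)) 0 - cosFT (nobleFRem (percolationNobleSplit d p hd hp)) k) :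
    NobleSimplifiedFormAt d p (BetaMap.nobleBetaOfInputs d i) :=
  nobleSimplifiedFormAt_of_assumptions₃ hd hp hp0 hWF hE (nobleAssumption41At_percolation hd p hp) h43
    (percolationNobleSplit_xiIotaAI_shift_trs hd hp) hN1 hN2 hN3 hN4 hRF

/-- **Prop. 4.5(ii) with the residual in the form delivered by App. D Steps 3–4**: as
`nobleSimplifiedFormAt_of_assumptions₃`, with (D.32) replaced by its INPUT — a totally rotationally symmetric
summable majorant `m ≥ R_F⁻` of second moment `Σ_x ‖x‖₂² m(x) ≤ β_{ΔR_F}(i)` ((D.15)–(D.31)); Step 5 is then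
the kernel theorem `nobleFRem_lower_of_majorant`. [cite: FitznerVanDerHofstad2016NoBLE, Prop. 4.5 (p. 1088);
App. D Steps 3–5 (D.15)–(D.32) (pp. 1113–1117)] -/
theorem nobleSimplifiedFormAt_of_assumptions₄ (hp0 : 0 < (p : ℝ)) (hWF : NobleInputsWF d i)
    (hE : PercolationNobleEquationAt d p) (h41 : NobleAssumption41At d p S) (h43 : NobleAssumption43At d p S i)
    (hTRS : IsTRS (fun x => ∑ ι, S.xiIotaAI ι (x + 𝐞 ι)))
    (hN1 : 0 ≤ BetaMap.betaCPhiLow d i.mu i.xiAlphaOneMinusZeroAtZero i.xiIotaAlphaIAtEi)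
    (hN2 : i.xiAbs + i.xiIotaAbs < 1) (hN3 : (BetaMap.nobleBetaOfInputs d i).βΨ < 1)
    (hN4 : 0 ≤ (BetaMap.nobleBetaOfInputs d i).αFlow)
    {m : Site d → ℝ} (hm : Summable m) (hm0 : ∀ x, 0 ≤ m x) (hmw : Summable fun x => euclidNorm x ^ 2 * m x)
    (hmT : IsTRS m) (hRm : ∀ x, -m x ≤ nobleFRem S x)
    (hβ : ∑' x, euclidNorm x ^ 2 * m x ≤ (BetaMap.nobleBetaOfInputs d i).βΔ) :
    NobleSimplifiedFormAt d p (BetaMap.nobleBetaOfInputs d i) := by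
  haveI : NeZero d := ⟨by omega⟩
  exact nobleSimplifiedFormAt_of_assumptions₃ hd hp hp0 hWF hE h41 h43 hTRS hN1 hN2 hN3 hN4 fun k _ =>
    nobleFRem_lower_of_majorant (nobleL1At_of_assumption43 hd hp hp0 h43) hm hm0 hmw hmT hRm hβ k

/-- **Percolation instance of `nobleSimplifiedFormAt_of_assumptions₄`.**
[cite: FitznerVanDerHofstad2016NoBLE, Prop. 4.5 (p. 1088), App. D (pp. 1110–1117); FitznerVanDerHofstad2017, §3.5] -/
theorem nobleSimplifiedFormAt_percolation₄ (hp0 : 0 < (p : ℝ)) (hWF : NobleInputsWF d i)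
    (hE : PercolationNobleEquationAt d p) (h43 : NobleAssumption43At d p (percolationNobleSplit d p hd hp) i)
    (hN1 : 0 ≤ BetaMap.betaCPhiLow d i.mu i.xiAlphaOneMinusZeroAtZero i.xiIotaAlphaIAtEi)
    (hN2 : i.xiAbs + i.xiIotaAbs < 1) (hN3 : (BetaMap.nobleBetaOfInputs d i).βΨ < 1)
    (hN4 : 0 ≤ (BetaMap.nobleBetaOfInputs d i).αFlow)
    {m : Site d → ℝ} (hm : Summable m) (hm0 : ∀ x, 0 ≤ m x) (hmw : Summable fun x => euclidNorm x ^ 2 * m x)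
    (hmT : IsTRS m) (hRm : ∀ x, -m x ≤ nobleFRem (percolationNobleSplit d p hd hp) x)
    (hβ : ∑' x, euclidNorm x ^ 2 * m x ≤ (BetaMap.nobleBetaOfInputs d i).βΔ) :
    NobleSimplifiedFormAt d p (BetaMap.nobleBetaOfInputs d i) :=
  nobleSimplifiedFormAt_of_assumptions₄ hd hp hp0 hWF hE (nobleAssumption41At_percolation hd p hp) h43
    (percolationNobleSplit_xiIotaAI_shift_trs hd hp) hN1 hN2 hN3 hN4 hm hm0 hmw hmT hRm hβ

end Assembly

end Literature.Probability.FitznerVanDerHofstad2017
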